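import Summits.AtomisticToContinuum.Crystallization.Theorems.OverbindingBudgetEnergyGapContraction

/-!
# OverbindingBudget · decomp-a2c lens-4 g35 — part XXIII-Z₁: force ROWS, the constant BUDGET, and the certified multi-stage contraction on a configuration

Helper file under `--supports stmt-AtomisticToContinuum-31280` (RDEF = `Theses.OverbindingBudget.RobustDefectLimitWindows`); closes nothing.

This file TYPES the row format of the GEO-OSC force certificate (the census's TAG 183-bis input format) and proves the per-configuration
contraction it feeds:
* `AdjRow a b n ĉ Φ τX τU Θ Gn rn Gl rl` — an ADJACENT row at the reference increment `ĉ`: for every ADMISSIBLE increment `v` (all adjacent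
  distances `‖v + lattice‖ ≥ 9/10`) in the box `|⟪v − ĉ, n⟫| ≤ τX`, `‖lat n (v − ĉ)‖ ≤ τU`: either the guard `Θ ≤ ‖layerForce a b (−v) + Φ n‖`
  fires, or two-channel expansivity `Gn |ΔH| ≤ rn + ‖…‖`, `Gl ‖Δlat‖ ≤ rl + ‖…‖`;
* `FarRow a b n V₀ s f ρ c c' τX τU` — a FAR row of span `s` at the word offset `V₀`: `‖layerForce a b (−V) − f n‖ ≤ ρ + c |ΔH| + c' ‖Δlat‖` on the
  box of radii `s·(τX, τU)` (secant form);
* `Budget S ρ c c' hlo τX τU Gn Gl C C' R₁ Θ rn rl ωX ωU` — part Y₂'s side conditions with the two OUTPUT radii `(ωX, ωU)`;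
* `StageOn a b n ĉ S hlo τX τU ωX ωU` — one stage REALISED on a configuration's reference profile `ĉ : ℤ → E3` (adjacent rows at every `ĉ m`,
  far rows at every occurring word offset `Σ_{k<i≤l} ĉ i`);
* ★ `devs_within_of_stageOn` — one certified stage maps the deviation box `(τX, τU)` into `(ωX, ωU)` (part Y₂'s `deviation_bands_of_force_rows`
  + the exact lattice bookkeeping `incr w m = ĉ m + e m + lattice`); ★★ `devs_within_of_chain` — `K` stages compose (induction), so a certificate
  may contract a coarse box in several certified steps (numerically necessary: from the clean-geometry box of radius `≈ 1/4` the adjacent secant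
  stiffness is only `≈ 5` against far feedback `≈ 3`; from a box of radius `≈ 2·10⁻³` it is `≈ 14` against `≈ 2`).
Gross separation violations inside a coarse box are excluded by ADMISSIBILITY (`le_norm_incr_add_lattice`: adjacent-layer distances of a
`δ`-separated stacked configuration are `≥ δ`), so the adjacent rows only quantify over the physically possible part of the box.
-/

namespace Summit.AtomisticToContinuum.Crystallization.Theorems.OverbindingBudgetEnergyForceRows

open Finset
open scoped RealInnerProductSpace
open Summit.AtomisticToContinuum.Crystallization.Theorems.ChartedPlanarOrderChunkFloor (E3)
open Summit.AtomisticToContinuum.Crystallization.Theorems.ChartedPlanarOrderDensityDichotomy (IsSep)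
open Summit.AtomisticToContinuum.Crystallization.Theorems.ChartedPlanarOrderDoorLayered (Layered)
open Summit.AtomisticToContinuum.Crystallization.Theorems.ChartedPlanarOrderProfileSlavingLJ (layerForce IsStacked gapStress incr)
open Summit.AtomisticToContinuum.Crystallization.Theorems.OverbindingBudgetRegistryCut (IsUnitNormal)
open Summit.AtomisticToContinuum.Crystallization.Theorems.OverbindingBudgetRegistrySquare (layerForce_add_lattice)
open Summit.AtomisticToContinuum.Crystallization.Theorems.OverbindingBudgetEnergyStraddleCount (span)
open Summit.AtomisticToContinuum.Crystallization.Theorems.OverbindingBudgetEnergyGapContraction (deviation_bands_of_force_rows)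

/-! ## §1 Vocabulary: lateral parts, rows, budget, a stage realised on a configuration -/

/-- the lateral part of `x` relative to the unit normal `n`. -/
noncomputable def lat (n x : E3) : E3 := x - ⟪x, n⟫ • n

/-- `lat` is additive over finite sums. -/
theorem lat_sum {ι : Type*} (n : E3) (s : Finset ι) (g : ι → E3) : lat n (∑ i ∈ s, g i) = ∑ i ∈ s, lat n (g i) := by
  simp only [lat, sum_inner, sum_smul, sum_sub_distrib]

/-- `‖lat n x‖ ≤ ‖x‖` and `|⟪x, n⟫| ≤ ‖x‖` for a unit `n`. -/
theorem norm_lat_le {n : E3} (hn : ‖n‖ = 1) (x : E3) : ‖lat n x‖ ≤ ‖x‖ ∧ |⟪x, n⟫| ≤ ‖x‖ := by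
  have h2 : |⟪x, n⟫| ≤ ‖x‖ := by simpa [hn] using abs_real_inner_le_norm x n
  have hsq : ‖lat n x‖ ^ 2 = ‖x‖ ^ 2 - ⟪x, n⟫ ^ 2 := by
    have e : ‖x - ⟪x, n⟫ • n‖ ^ 2 = ‖x‖ ^ 2 - 2 * ⟪x, ⟪x, n⟫ • n⟫ + ‖⟪x, n⟫ • n‖ ^ 2 := norm_sub_sq_real _ _
    rw [lat, e, inner_smul_right, norm_smul, hn, mul_one, Real.norm_eq_abs, sq_abs]; ring
  refine ⟨?_, h2⟩
  nlinarith [norm_nonneg (lat n x), norm_nonneg x, sq_nonneg ⟪x, n⟫, hsq]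

/-- **an adjacent row** at the reference increment `ĉ` on the box of radii `(τX, τU)` with far load `Φ`: for every ADMISSIBLE `v` in the box
(adjacent distances `≥ 9/10`), guard-or-two-channel-expansivity. -/
def AdjRow (a b n ĉ : E3) (Φ τX τU Θ Gn rn Gl rl : ℝ) : Prop :=
  ∀ v : E3, |⟪v - ĉ, n⟫| ≤ τX → ‖lat n (v - ĉ)‖ ≤ τU → (∀ i j : ℤ, 9 / 10 ≤ ‖v + (((i : ℤ) : ℝ) • a + ((j : ℤ) : ℝ) • b)‖) →
    Θ ≤ ‖layerForce a b (-v) + Φ • n‖ ∨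
      (Gn * |⟪v - ĉ, n⟫| ≤ rn + ‖layerForce a b (-v) + Φ • n‖ ∧ Gl * ‖lat n (v - ĉ)‖ ≤ rl + ‖layerForce a b (-v) + Φ • n‖)

/-- **a far row** of span `s` at the word offset `V₀` on the box of radii `s·(τX, τU)`: secant control of the span-`s` layer force round `f • n`. -/
def FarRow (a b n V₀ : E3) (s : ℕ) (f ρ c c' τX τU : ℝ) : Prop :=
  ∀ V : E3, |⟪V - V₀, n⟫| ≤ s * τX → ‖lat n (V - V₀)‖ ≤ s * τU →
    ‖layerForce a b (-V) - f • n‖ ≤ ρ + c * |⟪V - V₀, n⟫| + c' * ‖lat n (V - V₀)‖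

/-- **the constant budget** of one stage with input radii `(τX, τU)`, lower height `hlo` and OUTPUT radii `(ωX, ωU)` (part Y₂'s side conditions). -/
def Budget (S : ℕ) (ρ c c' : ℕ → ℝ) (hlo τX τU Gn Gl C C' R₁ Θ rn rl ωX ωU : ℝ) : Prop :=
  (∀ s, 0 ≤ ρ s) ∧ (∀ s, 0 ≤ c s) ∧ (∀ s, 0 ≤ c' s) ∧
    ∑ s ∈ Icc 2 S, (s : ℝ) * ρ s + 19 / hlo ^ 5 * (3 * (S : ℝ) ^ 3)⁻¹ ≤ R₁ ∧
    ∑ s ∈ Icc 2 S, (s : ℝ) ^ 2 * c s ≤ C ∧ ∑ s ∈ Icc 2 S, (s : ℝ) ^ 2 * c' s ≤ C' ∧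
    R₁ + C * τX + C' * τU < Θ ∧ C < Gn ∧ C' < Gl ∧ C' * C < (Gn - C) * (Gl - C') ∧ 1 ≤ S ∧ 0 < hlo ∧ 15 / 8 ≤ ((S : ℝ) + 1) * hlo ∧
    ((Gl - C') * (rn + R₁) + C' * (rl + R₁)) / ((Gn - C) * (Gl - C') - C' * C) ≤ ωX ∧
    ((Gn - C) * (rl + R₁) + C * (rn + R₁)) / ((Gn - C) * (Gl - C') - C' * C) ≤ ωU

/-- **one stage realised on a configuration's reference profile `ĉ`**: a budget, adjacent rows at every `ĉ m`, far rows at every word offset. -/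
def StageOn (a b n : E3) (ĉ : ℤ → E3) (S : ℕ) (hlo τX τU ωX ωU : ℝ) : Prop :=
  ∃ (f ρ c c' : ℕ → ℝ) (Gn Gl C C' R₁ Θ rn rl : ℝ), Budget S ρ c c' hlo τX τU Gn Gl C C' R₁ Θ rn rl ωX ωU ∧
    (∀ m : ℤ, AdjRow a b n (ĉ m) (∑ s ∈ Icc 2 S, (s : ℝ) * f s) τX τU Θ Gn rn Gl rl) ∧
    (∀ k l : ℤ, k < l → 2 ≤ span (k, l) → span (k, l) ≤ S →
      FarRow a b n (∑ i ∈ Ioc k l, ĉ i) (span (k, l)) (f (span (k, l))) (ρ (span (k, l))) (c (span (k, l))) (c' (span (k, l))) τX τU)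

/-! ## §2 Admissibility and the height decomposition -/

variable {a b n : E3} {w : ℤ → E3} {δ : ℝ}

/-- adjacent-layer distances of a `δ`-separated stacked configuration: `δ ≤ ‖incr w m + (i a + j b)‖`. [bookkeeping] -/
theorem le_norm_incr_add_lattice (hS : IsSep δ (Layered a b w)) (hn : IsUnitNormal a b n) (hpos : ∀ m : ℤ, 0 < ⟪incr w m, n⟫)
    (m i j : ℤ) : δ ≤ ‖incr w m + (((i : ℤ) : ℝ) • a + ((j : ℤ) : ℝ) • b)‖ := by
  have hp : (((i : ℤ) : ℝ) • a + ((j : ℤ) : ℝ) • b) + w m ∈ Layered a b w := ⟨m, i, j, rfl⟩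
  have hq : w (m - 1) ∈ Layered a b w := ⟨m - 1, 0, 0, by simp⟩
  have hv : (((i : ℤ) : ℝ) • a + ((j : ℤ) : ℝ) • b) + w m - w (m - 1) = incr w m + (((i : ℤ) : ℝ) • a + ((j : ℤ) : ℝ) • b) := by
    unfold incr; abel
  have han : ⟪a, n⟫ = 0 := (real_inner_comm n a).trans hn.2.1
  have hbn : ⟪b, n⟫ = 0 := (real_inner_comm n b).trans hn.2.2
  have hne : (((i : ℤ) : ℝ) • a + ((j : ℤ) : ℝ) • b) + w m ≠ w (m - 1) := by
    intro h
    have h1 : ⟪incr w m + (((i : ℤ) : ℝ) • a + ((j : ℤ) : ℝ) • b), n⟫ = 0 := by rw [← hv, h, sub_self, inner_zero_left]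
    rw [inner_add_left, inner_add_left, inner_smul_left, inner_smul_left, han, hbn] at h1
    simp only [mul_zero, add_zero] at h1
    linarith [hpos m]
  have := hS _ hp _ hq hne
  rwa [dist_eq_norm, hv] at this

/-- heights split along `incr w m = ĉ m + e m + lattice`: `⟪incr w m, n⟫ = ⟪ĉ m, n⟫ + ⟪e m, n⟫`. [bookkeeping] -/
theorem inner_incr_eq (hn : IsUnitNormal a b n) {ĉ e : ℤ → E3} {u v : ℤ → ℤ}
    (hdec : ∀ m : ℤ, incr w m = ĉ m + e m + ((((u m : ℤ) : ℝ)) • a + (((v m : ℤ) : ℝ)) • b)) (m : ℤ) :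
    ⟪incr w m, n⟫ = ⟪ĉ m, n⟫ + ⟪e m, n⟫ := by
  have han : ⟪a, n⟫ = 0 := (real_inner_comm n a).trans hn.2.1
  have hbn : ⟪b, n⟫ = 0 := (real_inner_comm n b).trans hn.2.2
  rw [hdec m, inner_add_left, inner_add_left, inner_add_left, inner_smul_left, inner_smul_left, han, hbn]; simp

/-! ## §3 ★ One certified stage on a configuration -/

/-- ★ **one certified stage**: increments `incr w m = ĉ m + e m + lattice`, deviations in the box `(τX, τU)`, `hlo ≤` every gap height, and a
stage realised on `ĉ` ⟹ deviations in the output box `(ωX, ωU)`. -/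
theorem devs_within_of_stageOn (hδ : 9 / 10 ≤ δ) (hab : LinearIndependent ℝ ![a, b]) (hst : IsStacked a b w)
    (hS : IsSep δ (Layered a b w)) (hn : IsUnitNormal a b n) (ha : ‖a‖ ≤ 17 / 16) (hb : ‖b‖ ≤ 17 / 16)
    (h0 : ∀ m : ℤ, gapStress a b m (incr w) = 0) (hpos : ∀ m : ℤ, 0 < ⟪incr w m, n⟫)
    {ĉ e : ℤ → E3} {u v : ℤ → ℤ} {hlo τX τU ωX ωU : ℝ} {S : ℕ}
    (hdec : ∀ m : ℤ, incr w m = ĉ m + e m + ((((u m : ℤ) : ℝ)) • a + (((v m : ℤ) : ℝ)) • b))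
    (hband : ∀ m : ℤ, hlo ≤ ⟪incr w m, n⟫) (he : ∀ m : ℤ, |⟪e m, n⟫| ≤ τX ∧ ‖lat n (e m)‖ ≤ τU)
    (hSO : StageOn a b n ĉ S hlo τX τU ωX ωU) (m : ℤ) : |⟪e m, n⟫| ≤ ωX ∧ ‖lat n (e m)‖ ≤ ωU := by
  obtain ⟨f, ρ, c, c', Gn, Gl, C, C', R₁, Θ, rn, rl, hB, hADJ, hFAR⟩ := hSO
  obtain ⟨hρ0, hc0, hc'0, hR, hC, hC', hΘ, hp, hq, hdet, hS1, hlo0, hSh, hωX, hωU⟩ := hB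
  -- the deviation profiles
  set x : ℤ → ℝ := fun m => |⟪e m, n⟫| with hxdef
  set uu : ℤ → ℝ := fun m => ‖lat n (e m)‖ with hudef
  have hx : ∀ m, 0 ≤ x m ∧ x m ≤ τX := fun m => ⟨abs_nonneg _, (he m).1⟩
  have hu : ∀ m, 0 ≤ uu m ∧ uu m ≤ τU := fun m => ⟨norm_nonneg _, (he m).2⟩
  -- the layer force at `-incr w m` is the layer force at `-(ĉ m + e m)`
  have hLm : ∀ m : ℤ, layerForce a b (-incr w m) = layerForce a b (-(ĉ m + e m)) := by
    intro m
    rw [hdec m, show -(ĉ m + e m + ((((u m : ℤ) : ℝ)) • a + (((v m : ℤ) : ℝ)) • b)) =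
      -(ĉ m + e m) + (((((-u m : ℤ)) : ℝ)) • a + ((((-v m : ℤ)) : ℝ)) • b) by push_cast; module, layerForce_add_lattice]
  -- admissibility of `ĉ m + e m`
  have hadm : ∀ m i j : ℤ, 9 / 10 ≤ ‖ĉ m + e m + (((i : ℤ) : ℝ) • a + ((j : ℤ) : ℝ) • b)‖ := by
    intro m i j
    have e1 : ĉ m + e m + (((i : ℤ) : ℝ) • a + ((j : ℤ) : ℝ) • b) =
        incr w m + ((((i - u m : ℤ)) : ℝ) • a + (((j - v m : ℤ)) : ℝ) • b) := by
      rw [hdec m]; push_cast; module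
    rw [e1]; exact hδ.trans (le_norm_incr_add_lattice hS hn hpos m _ _)
  -- ADJ
  have hADJ' : ∀ m : ℤ, Θ ≤ ‖layerForce a b (-incr w m) + (∑ s ∈ Icc 2 S, (s : ℝ) * f s) • n‖ ∨
      (Gn * x m ≤ rn + ‖layerForce a b (-incr w m) + (∑ s ∈ Icc 2 S, (s : ℝ) * f s) • n‖ ∧
        Gl * uu m ≤ rl + ‖layerForce a b (-incr w m) + (∑ s ∈ Icc 2 S, (s : ℝ) * f s) • n‖) := by
    intro m
    have h := hADJ m (ĉ m + e m) (by rw [add_sub_cancel_left]; exact (he m).1) (by rw [add_sub_cancel_left]; exact (he m).2) (hadm m)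
    rw [add_sub_cancel_left] at h
    rw [hLm m]; exact h
  -- FAR
  have hFAR' : ∀ k l : ℤ, k < l → 2 ≤ span (k, l) → span (k, l) ≤ S →
      ‖layerForce a b (w k - w l) - f (span (k, l)) • n‖ ≤
        ρ (span (k, l)) + c (span (k, l)) * ∑ i ∈ Ioc k l, x i + c' (span (k, l)) * ∑ i ∈ Ioc k l, uu i := by
    intro k l hkl hs2 hsS
    have hoff : w l - w k = ∑ i ∈ Ioc k l, incr w i := by
      rw [← Summit.AtomisticToContinuum.Crystallization.Theorems.ChartedPlanarOrderProfileSlavingLJ.offsetOf_incr w hkl.le]; rfl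
    set V : E3 := ∑ i ∈ Ioc k l, (ĉ i + e i) with hVdef
    set U₁ : ℤ := ∑ i ∈ Ioc k l, u i with hU₁
    set U₂ : ℤ := ∑ i ∈ Ioc k l, v i with hU₂
    have hsplit : w l - w k = V + ((((U₁ : ℤ) : ℝ)) • a + (((U₂ : ℤ) : ℝ)) • b) := by
      rw [hoff, hVdef, hU₁, hU₂]
      simp_rw [hdec]
      push_cast
      rw [sum_smul, sum_smul, ← sum_add_distrib, ← sum_add_distrib]
    have hL : layerForce a b (w k - w l) = layerForce a b (-V) := by
      rw [← neg_sub, hsplit, show -(V + ((((U₁ : ℤ) : ℝ)) • a + (((U₂ : ℤ) : ℝ)) • b)) =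
        -V + (((((-U₁ : ℤ)) : ℝ)) • a + ((((-U₂ : ℤ)) : ℝ)) • b) by push_cast; module, layerForce_add_lattice]
    have hΔ : V - ∑ i ∈ Ioc k l, ĉ i = ∑ i ∈ Ioc k l, e i := by rw [hVdef, sum_add_distrib]; abel
    have hn_le : |⟪V - ∑ i ∈ Ioc k l, ĉ i, n⟫| ≤ ∑ i ∈ Ioc k l, x i := by
      rw [hΔ, sum_inner]; exact abs_sum_le_sum_abs _ _
    have hl_le : ‖lat n (V - ∑ i ∈ Ioc k l, ĉ i)‖ ≤ ∑ i ∈ Ioc k l, uu i := by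
      rw [hΔ, lat_sum]; exact norm_sum_le _ _
    have hcard : ((Ioc k l).card : ℝ) = (span (k, l) : ℝ) := by rw [Int.card_Ioc]; simp [span]
    have hsx : ∑ i ∈ Ioc k l, x i ≤ (span (k, l) : ℝ) * τX := by
      calc ∑ i ∈ Ioc k l, x i ≤ ∑ _i ∈ Ioc k l, τX := sum_le_sum fun i _ => (hx i).2
        _ = (span (k, l) : ℝ) * τX := by rw [sum_const, nsmul_eq_mul, hcard]
    have hsu : ∑ i ∈ Ioc k l, uu i ≤ (span (k, l) : ℝ) * τU := by
      calc ∑ i ∈ Ioc k l, uu i ≤ ∑ _i ∈ Ioc k l, τU := sum_le_sum fun i _ => (hu i).2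
        _ = (span (k, l) : ℝ) * τU := by rw [sum_const, nsmul_eq_mul, hcard]
    have hrow := hFAR k l hkl hs2 hsS V (hn_le.trans hsx) (hl_le.trans hsu)
    rw [hL]
    have i1 := mul_le_mul_of_nonneg_left hn_le (hc0 (span (k, l)))
    have i2 := mul_le_mul_of_nonneg_left hl_le (hc'0 (span (k, l)))
    linarith
  have key := deviation_bands_of_force_rows hδ hab hst hS hn ha hb h0 hlo0 hband hx hu hADJ' hFAR' hρ0 hc0 hc'0 hR hC hC' hΘ hp hq hdet
    hS1 hSh
  exact ⟨(key.1 m).trans hωX, (key.2 m).trans hωU⟩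

/-! ## §4 ★★ A chain of certified stages -/

/-- ★★ **K certified stages compose**: from deviations in the box `(τX 0, τU 0)` and, for each `k < K`, a stage realised on `ĉ` mapping the box
`(τX k, τU k)` into `(τX (k+1), τU (k+1))` with a lower height `hlo k` valid on the `k`-th box, the deviations lie in `(τX K, τU K)`. -/
theorem devs_within_of_chain (hδ : 9 / 10 ≤ δ) (hab : LinearIndependent ℝ ![a, b]) (hst : IsStacked a b w)
    (hS : IsSep δ (Layered a b w)) (hn : IsUnitNormal a b n) (ha : ‖a‖ ≤ 17 / 16) (hb : ‖b‖ ≤ 17 / 16)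
    (h0 : ∀ m : ℤ, gapStress a b m (incr w) = 0) (hpos : ∀ m : ℤ, 0 < ⟪incr w m, n⟫)
    {ĉ e : ℤ → E3} {u v : ℤ → ℤ} {K : ℕ} {S : ℕ → ℕ} {hlo τX τU : ℕ → ℝ}
    (hdec : ∀ m : ℤ, incr w m = ĉ m + e m + ((((u m : ℤ) : ℝ)) • a + (((v m : ℤ) : ℝ)) • b))
    (he0 : ∀ m : ℤ, |⟪e m, n⟫| ≤ τX 0 ∧ ‖lat n (e m)‖ ≤ τU 0)
    (hhlo : ∀ k : ℕ, k < K → ∀ m : ℤ, |⟪e m, n⟫| ≤ τX k → hlo k ≤ ⟪incr w m, n⟫)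
    (hCH : ∀ k : ℕ, k < K → StageOn a b n ĉ (S k) (hlo k) (τX k) (τU k) (τX (k + 1)) (τU (k + 1))) :
    ∀ m : ℤ, |⟪e m, n⟫| ≤ τX K ∧ ‖lat n (e m)‖ ≤ τU K := by
  suffices H : ∀ k : ℕ, k ≤ K → ∀ m : ℤ, |⟪e m, n⟫| ≤ τX k ∧ ‖lat n (e m)‖ ≤ τU k from H K le_rfl
  intro k
  induction k with
  | zero => exact fun _ => he0
  | succ k ih =>
    intro hk m
    have hk' : k < K := Nat.lt_of_succ_le hk
    have hek := ih hk'.le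
    exact devs_within_of_stageOn hδ hab hst hS hn ha hb h0 hpos hdec (fun m => hhlo k hk' m (hek m).1) hek (hCH k hk') m

end Summit.AtomisticToContinuum.Crystallization.Theorems.OverbindingBudgetEnergyForceRows
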